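import Summits.AtomisticToContinuum.BoseEinsteinCondensation.Theorems.BECCutLineWeakDisorderWitnessTransferHeig
import Summits.AtomisticToContinuum.BoseEinsteinCondensation.Theorems.TwoReplicaTransienceBound.Negative.ConstantAtLeastOne
import Literature.MathematicalPhysics.QuantumManyBody.GroundStateFeynmanKacHeatKernel
import Literature.MathematicalPhysics.QuantumManyBody.BoseGasClusterStates
import Literature.Probability.RandomPlanarGeometry.BrownianOscillationTail
import HarnessLib

/-!
# Crux `TwoReplicaTransienceBound` (stmt-AtomisticToContinuum-9687): free-gas case, I — tools
# (log-convexity ladder with a general step; one line = survival probability; survival floor on the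
# middle cube at the diffusive scale)

Support file (does not close the item) for the crux
`Summit.AtomisticToContinuum.BoseEinsteinCondensation.Theses.BECCutLineWeakDisorder.TwoReplicaTransienceBound`
(route `BECCutLineWeakDisorder`, line `SketchIdeator1`, lead c2). Tools for the FREE-GAS case of the crux
(dossier item E-free; the ratio bound is `…TwoReplicaTransienceBoundFreeOneRatio.lean`, the reduction of
the crux's integral at `v ≡ 0` to it is `…TwoReplicaTransienceBoundFreeGas.lean`):

* `fkNormSq_ladder` — **log-convexity ladder with step `h > 0`**: `Z(T-h)·Z(2h) ≤ Z(0)·Z(T)` for `T ≥ h`,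
  `Z(s) = ‖e^{-sH_N}1‖₂²`, any measurable pair potential (general-step form of
  `PerBox.fkNormSq_sub_one_mul_two_le`); `fkSemigroup_one_sq_mul_le` — with the `L² → L^∞` smoothing
  over one step (`fkSemigroup_le_L2`): `Z_T(X)²·Z(2h) ≤ κ_h Z(0) Z(T)`, `κ_h = (4πh)^{-3N/2}`;
* `fkPartition_config_one` — ONE line has no pair interaction: `Z^{(1)}_T(x) = P_x(τ_{Λ_L} > T)`, the
  Dirichlet survival probability; `lintegral_config_one`, `fkNormSq_one_config_one` (`(ℝ³)¹ ≅ ℝ³`);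
* `survives_one_ge`, `fkPartition_one_ge_on_middle` — **survival floor at the diffusive scale**: for
  `0 ≤ T ≤ L²/960` and `x` in the middle cube `(L/4, 3L/4)³`, `Z^{(1)}_T(x) ≥ q₀ = 1 - 6e⁻⁵ > 0` (exit
  needs a coordinate excursion `L/(4√6)`: `measure_not_survives_le` and the Gaussian running-maximum tail
  `measure_exists_le_abs_brownian_le_exp`, `2e^{-L²/(192T)} ≤ 2e⁻⁵` per coordinate); `volume_middle`.

## References

* K. L. Chung, Z. Zhao, *From Brownian Motion to Schrödinger's Equation* (1995), Thm 3.17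
  (`T_t : L² → L^∞`, `p ≤ (2πt)^{-d/2}`). [ChungZhao1995]
* D. Revuz, M. Yor, *Continuous Martingales and Brownian Motion* (1999), Ch. II Prop. (1.8) (tail of the
  running maximum). [RevuzYor1999]
-/

noncomputable section

open MeasureTheory Filter Set Metric
open scoped ENNReal NNReal Topology

namespace Summit.AtomisticToContinuum.BoseEinsteinCondensation.Cruxes.TwoReplicaTransienceBound.FreeGas

open Literature.MathematicalPhysics.QuantumManyBody.BoseGas
open Summit.AtomisticToContinuum.BoseEinsteinCondensation.Theorems.CutLineWitness
open Literature.Probability.Process (preWienerMeasure brownian)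

variable {N : ℕ}

/-! ### The log-convexity ladder with a general step -/

/-- **Log-convexity ladder with step `h > 0`**: `Z(T-h)·Z(2h) ≤ Z(0)·Z(T)` for `T ≥ h`, where
`Z(s) = ‖e^{-sH_N}1‖₂² = fkNormSq v L s 1`, for every measurable pair potential. (Midpoint log-convexity
`fkNormSq_one_midpoint_sq_le`, iterated from `T` down into `[h, 2h)`, where monotonicity closes it;
`PerBox.fkNormSq_sub_one_mul_two_le` is the case `h = 1`.) [cite: Simon1982, §A1 (A7) p. 449] -/
theorem fkNormSq_ladder {v : ℝ → ℝ≥0∞} (hv : Measurable v) (L : ℝ) {h : ℝ} (hh : 0 < h) {T : ℝ}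
    (hT : h ≤ T) :
    fkNormSq (N := N) v L (T - h) (fun _ => (1 : ℝ≥0∞)) *
        fkNormSq (N := N) v L (2 * h) (fun _ => (1 : ℝ≥0∞)) ≤
      fkNormSq (N := N) v L 0 (fun _ => (1 : ℝ≥0∞)) *
        fkNormSq (N := N) v L T (fun _ => (1 : ℝ≥0∞)) := by
  obtain ⟨Z, hZ⟩ : ∃ Z : ℝ → ℝ≥0∞, ∀ s, Z s = fkNormSq (N := N) v L s (fun _ => (1 : ℝ≥0∞)) :=
    ⟨_, fun _ => rfl⟩
  simp only [← hZ]
  by_cases h2 : Z (2 * h) = 0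
  · simp [h2]
  have h2' : fkNormSq (N := N) v L (2 * h) (fun _ => (1 : ℝ≥0∞)) ≠ 0 := by rwa [← hZ]
  have hne : ∀ s : ℝ, 0 ≤ s → Z s ≠ 0 := fun s hs => by
    rw [hZ]; exact fkNormSq_one_ne_zero hv L (by positivity) h2' hs
  have htop : ∀ s : ℝ, 0 ≤ s → Z s ≠ ⊤ := fun s hs => by
    rw [hZ]; exact ne_top_of_le_ne_top (volume_boxN_lt_top N L).ne (fkNormSq_one_le v hs)
  have hanti : ∀ a b : ℝ, 0 ≤ a → a ≤ b → Z b ≤ Z a := fun a b ha hab => by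
    rw [hZ, hZ]; exact fkNormSq_one_antitone hv L ha hab
  have hmid : ∀ a b : ℝ, 0 ≤ a → 0 ≤ b → Z ((a + b) / 2) ^ 2 ≤ Z a * Z b := fun a b ha hb => by
    rw [hZ, hZ, hZ]; exact fkNormSq_one_midpoint_sq_le hv L ha hb
  have key : ∀ k : ℕ, ∀ T : ℝ, h + k * h ≤ T → T < 2 * h + k * h →
      Z (T - h) * Z (2 * h) ≤ Z 0 * Z T := by
    intro k
    induction k with
    | zero =>
      intro T h1 hlt
      simp only [Nat.cast_zero, zero_mul, add_zero] at h1 hlt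
      exact mul_le_mul' (hanti 0 (T - h) le_rfl (by linarith)) (hanti T (2 * h) (by linarith) hlt.le)
    | succ k ih =>
      intro T h1 hlt
      push_cast at h1 hlt
      have hk : (0 : ℝ) ≤ k := Nat.cast_nonneg k
      have hkh : 0 ≤ k * h := mul_nonneg hk hh.le
      have hT2 : 0 ≤ T - 2 * h := by nlinarith
      have hm := hmid (T - 2 * h) T hT2 (by linarith)
      rw [show (T - 2 * h + T) / 2 = T - h by ring] at hm
      have hih := ih (T - h) (by linarith) (by linarith)
      rw [show T - h - h = T - 2 * h by ring] at hih
      have h3 : Z (T - h) * (Z (T - h) * Z (2 * h)) ≤ Z (T - h) * (Z 0 * Z T) :=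
        calc Z (T - h) * (Z (T - h) * Z (2 * h)) = Z (T - h) ^ 2 * Z (2 * h) := by ring
          _ ≤ Z (T - 2 * h) * Z T * Z (2 * h) := mul_le_mul' hm le_rfl
          _ = Z (T - 2 * h) * Z (2 * h) * Z T := by ring
          _ ≤ Z 0 * Z (T - h) * Z T := mul_le_mul' hih le_rfl
          _ = Z (T - h) * (Z 0 * Z T) := by ring
      exact (ENNReal.mul_le_mul_iff_right (hne _ (by linarith)) (htop _ (by linarith))).1 h3
  have h0 : 0 ≤ (T - h) / h := div_nonneg (by linarith) hh.le
  refine key ⌊(T - h) / h⌋₊ T ?_ ?_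
  · have h1 : (⌊(T - h) / h⌋₊ : ℝ) * h ≤ T - h := by
      have := Nat.floor_le h0
      calc (⌊(T - h) / h⌋₊ : ℝ) * h ≤ (T - h) / h * h := mul_le_mul_of_nonneg_right this hh.le
        _ = T - h := div_mul_cancel₀ _ hh.ne'
    linarith
  · have h1 : T - h < (⌊(T - h) / h⌋₊ + 1 : ℝ) * h := by
      have := Nat.lt_floor_add_one ((T - h) / h)
      calc T - h = (T - h) / h * h := (div_mul_cancel₀ _ hh.ne').symm
        _ < (⌊(T - h) / h⌋₊ + 1 : ℝ) * h := mul_lt_mul_of_pos_right this hh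
    linarith

/-- **Sup bound over one step `h`**: `Z_T(X)²·Z(2h) ≤ κ_h · Z(0) · Z(T)` for all `T ≥ h > 0` and all `X`,
with `κ_h` the square of the `L² → L^∞` constant of `fkSemigroup_le_L2` at time `h` (semigroup law at
time `h`, smoothing, and the ladder `fkNormSq_ladder`). [cite: ChungZhao1995, Thm 3.17] -/
theorem fkSemigroup_one_sq_mul_le {v : ℝ → ℝ≥0∞} (hv : Measurable v) (L : ℝ) {h : ℝ} (hh : 0 < h)
    {T : ℝ} (hT : h ≤ T) (X : Config N) :
    fkSemigroup v L T (fun _ => (1 : ℝ≥0∞)) X ^ 2 *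
        fkNormSq (N := N) v L (2 * h) (fun _ => (1 : ℝ≥0∞)) ≤
      (∏ _i : Fin N, ∏ _k : Fin 3, ENNReal.ofReal (Real.sqrt (2 * Real.pi * (2 * h.toNNReal)))⁻¹) *
        (fkNormSq (N := N) v L 0 (fun _ => (1 : ℝ≥0∞)) *
          fkNormSq (N := N) v L T (fun _ => (1 : ℝ≥0∞))) := by
  obtain ⟨κ, hκ⟩ : ∃ κ : ℝ≥0∞, κ = (∏ _i : Fin N, ∏ _k : Fin 3,
    ENNReal.ofReal (Real.sqrt (2 * Real.pi * (2 * h.toNNReal)))⁻¹) := ⟨_, rfl⟩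
  rw [← hκ]
  have hTh : 0 ≤ T - h := by linarith
  have h1m : Measurable (fun _ : Config N => (1 : ℝ≥0∞)) := measurable_const
  have hmeasT : Measurable (fkSemigroup v L (T - h) fun _ : Config N => (1 : ℝ≥0∞)) :=
    measurable_fkSemigroup hv L (T - h) h1m
  have hsplit : fkSemigroup v L T (fun _ => (1 : ℝ≥0∞)) X =
      fkSemigroup v L h (fkSemigroup v L (T - h) fun _ => (1 : ℝ≥0∞)) X := by
    have := fkSemigroup_add hv L hh.le hTh h1m X
    rwa [add_sub_cancel] at this
  have hsq : (∫⁻ Y : Config N, fkSemigroup v L (T - h) (fun _ => (1 : ℝ≥0∞)) Y ^ (2 : ℝ)) =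
      fkNormSq (N := N) v L (T - h) (fun _ => (1 : ℝ≥0∞)) := by
    rw [fkNormSq]; exact lintegral_congr fun Y => ENNReal.rpow_two _
  have hhalf : ∀ x : ℝ≥0∞, (x ^ (1 / 2 : ℝ)) ^ 2 = x := fun x => by
    rw [← ENNReal.rpow_two, ← ENNReal.rpow_mul]
    norm_num
  have hL2 := fkSemigroup_le_L2 v L hh hmeasT X
  rw [← hκ] at hL2
  have hstep : fkSemigroup v L T (fun _ => (1 : ℝ≥0∞)) X ^ 2 ≤
      κ * fkNormSq (N := N) v L (T - h) (fun _ => (1 : ℝ≥0∞)) :=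
    calc fkSemigroup v L T (fun _ => (1 : ℝ≥0∞)) X ^ 2
        = (fkSemigroup v L h (fkSemigroup v L (T - h) fun _ => (1 : ℝ≥0∞)) X) ^ 2 := by rw [hsplit]
      _ ≤ (κ ^ (1 / 2 : ℝ) * (∫⁻ Y : Config N, fkSemigroup v L (T - h) (fun _ => (1 : ℝ≥0∞)) Y ^
            (2 : ℝ)) ^ (1 / 2 : ℝ)) ^ 2 := pow_le_pow_left' hL2 2
      _ = κ * fkNormSq (N := N) v L (T - h) (fun _ => (1 : ℝ≥0∞)) := by
          rw [mul_pow, hhalf, hhalf, hsq]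
  calc fkSemigroup v L T (fun _ => (1 : ℝ≥0∞)) X ^ 2 * fkNormSq (N := N) v L (2 * h) (fun _ => 1)
      ≤ κ * fkNormSq (N := N) v L (T - h) (fun _ => 1) * fkNormSq (N := N) v L (2 * h) (fun _ => 1) :=
        mul_le_mul' hstep le_rfl
    _ = κ * (fkNormSq (N := N) v L (T - h) (fun _ => 1) * fkNormSq (N := N) v L (2 * h) (fun _ => 1)) :=
        mul_assoc _ _ _
    _ ≤ κ * (fkNormSq (N := N) v L 0 (fun _ => 1) * fkNormSq (N := N) v L T (fun _ => 1)) :=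
        mul_le_mul' le_rfl (fkNormSq_ladder hv L hh hT)

/-! ### One line: no pair interaction, `Z^{(1)}_T` is the Dirichlet survival probability -/

/-- The one-line action vanishes (a single particle has no pair interaction, `interaction_one`).
[folklore] -/
theorem pathAction_config_one (v : ℝ → ℝ≥0∞) (T : ℝ) (X : Config 1) (ω : PathSpace 1) :
    pathAction v T X ω = 0 := by
  simp [pathAction, interaction_one]

/-- **One line: the partition function is the survival probability** `Z^{(1)}_T(X) = P(τ_{Λ_L} > T)`.
[folklore] -/
theorem fkPartition_config_one (v : ℝ → ℝ≥0∞) (L T : ℝ) (X : Config 1) :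
    fkPartition v L T X = wienerPaths 1 (survives L T X) := by
  rw [fkPartition, fkSemigroup]
  have hw : ∀ ω, fkWeight v L T X ω * 1 = (survives L T X).indicator 1 ω := fun ω => by
    rw [mul_one, fkWeight]
    by_cases hω : ω ∈ survives L T X
    · simp [Set.indicator_of_mem hω, pathAction_config_one]
    · simp [Set.indicator_of_notMem hω]
  simp_rw [hw]
  exact lintegral_indicator_one (measurableSet_survives L T X)

/-- Integration over `Config 1 = (ℝ³)¹` is integration over `ℝ³`. [folklore] -/
theorem lintegral_config_one (F : Config 1 → ℝ≥0∞) :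
    ∫⁻ X : Config 1, F X = ∫⁻ x : Space, F (fun _ => x) := by
  have hmp := volume_preserving_funUnique (Fin 1) Space
  have hfun : ∀ X : Config 1, X = fun _ => X 0 := fun X => funext fun i => by
    rw [Subsingleton.elim i 0]
  calc ∫⁻ X : Config 1, F X = ∫⁻ X : Config 1, F (fun _ => (MeasurableEquiv.funUnique (Fin 1) Space) X) :=
        lintegral_congr fun X => by rw [MeasurableEquiv.funUnique_apply]; exact congrArg F (hfun X)
    _ = ∫⁻ x : Space, F (fun _ => x) :=
        hmp.lintegral_comp_emb (MeasurableEquiv.measurableEmbedding _) (fun x : Space => F (fun _ => x))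
          |>.symm ▸ rfl

/-- `x ↦ Z^{(1)}_T(x)` is measurable. [folklore] -/
theorem measurable_fkPartition_one {v : ℝ → ℝ≥0∞} (hv : Measurable v) (L T : ℝ) :
    Measurable fun x : Space => fkPartition (N := 1) v L T (fun _ => x) :=
  (measurable_fkSemigroup (N := 1) hv L T measurable_const).comp (measurable_pi_lambda _ fun _ => measurable_id)

/-- `‖Z^{(1)}_T‖₂² = ∫ Z^{(1)}_T(x)² dx` over `ℝ³`. [folklore] -/
theorem fkNormSq_one_config_one (v : ℝ → ℝ≥0∞) (L T : ℝ) :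
    fkNormSq (N := 1) v L T (fun _ => (1 : ℝ≥0∞)) = ∫⁻ x : Space, fkPartition (N := 1) v L T (fun _ => x) ^ 2 := by
  rw [fkNormSq]
  exact lintegral_config_one _

/-! ### The middle cube and the survival lower bound -/

/-- The middle cube `(L/4, 3L/4)³` of the box. -/
theorem volume_middle (L : ℝ) :
    volume {x : Space | ∀ k, x k ∈ Set.Ioo (L / 4) (3 * L / 4)} = ENNReal.ofReal (L / 2) ^ 3 := by
  have h : {x : Space | ∀ k, x k ∈ Set.Ioo (L / 4) (3 * L / 4)} =
      (@WithLp.ofLp 2 (Fin 3 → ℝ)) ⁻¹' (Set.univ.pi fun _ => Set.Ioo (L / 4) (3 * L / 4)) := by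
    ext x; simp
  rw [h, (PiLp.volume_preserving_ofLp (Fin 3)).measure_preimage
    (MeasurableSet.univ_pi fun _ => measurableSet_Ioo).nullMeasurableSet, volume_pi_pi]
  simp only [Real.volume_Ioo, Finset.prod_const, Finset.card_univ, Fintype.card_fin]
  congr 1; congr 1; ring

/-- The middle cube is measurable. [folklore] -/
theorem measurableSet_middle (L : ℝ) :
    MeasurableSet {x : Space | ∀ k, x k ∈ Set.Ioo (L / 4) (3 * L / 4)} := by
  have h : {x : Space | ∀ k, x k ∈ Set.Ioo (L / 4) (3 * L / 4)} =
      (@WithLp.ofLp 2 (Fin 3 → ℝ)) ⁻¹' (Set.univ.pi fun _ => Set.Ioo (L / 4) (3 * L / 4)) := by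
    ext x; simp
  rw [h]
  exact (MeasurableSet.univ_pi fun _ => measurableSet_Ioo).preimage
    (PiLp.volume_preserving_ofLp (Fin 3)).measurable

/-- From the middle cube, the closed `L/4`-ball (of the one-line configuration) lies in the open box.
[folklore] -/
theorem closedBall_subset_boxN_one {L : ℝ} {x : Space} (hx : ∀ k, x k ∈ Set.Ioo (L / 4) (3 * L / 4)) :
    Metric.closedBall (fun _ : Fin 1 => x) (L / 4) ⊆ boxN 1 L := by
  intro X hX i k
  have h1 : dist (X i) x ≤ L / 4 := (dist_le_pi_dist X (fun _ : Fin 1 => x) i).trans (mem_closedBall.1 hX)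
  have h2 : |X i k - x k| ≤ L / 4 := by
    have h := PiLp.norm_apply_le (X i - x) k
    rw [WithLp.ofLp_sub, Pi.sub_apply, Real.norm_eq_abs, ← dist_eq_norm] at h
    exact h.trans h1
  obtain ⟨hl, hu⟩ := hx k
  obtain ⟨ha, hb⟩ := abs_le.1 h2
  constructor <;> linarith

/-- **Survival lower bound on the middle cube at the diffusive scale**: for `0 < s ≤ L²/960`, a line
started in `(L/4, 3L/4)³` survives in `Λ_L` up to time `s` with probability `≥ q₀ = 1 - 6e⁻⁵` (exit
requires a Brownian coordinate to reach `L/(4√6)`, a Gaussian running-maximum tail `≤ 2e^{-L²/(192 s)}`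
per coordinate). [cite: RevuzYor1999, Ch. II Prop. (1.8)] -/
theorem survives_one_ge {L : ℝ} (hL : 0 < L) {x : Space} (hx : ∀ k, x k ∈ Set.Ioo (L / 4) (3 * L / 4))
    {s : ℝ≥0} (hs0 : 0 < s) (hs : (s : ℝ) ≤ L ^ 2 / 960) :
    1 - 6 * ENNReal.ofReal (Real.exp (-5)) ≤ wienerPaths 1 (survives L s (fun _ : Fin 1 => x)) := by
  haveI := Literature.Probability.RandomPlanarGeometry.isProbabilityMeasure_preWienerMeasure'
  have hr : 0 < L / 4 := by positivity
  have ha : 0 < L / 4 / Real.sqrt 6 := div_pos hr (Real.sqrt_pos.2 (by norm_num))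
  -- complement bound: three Gaussian tails
  have hc : wienerPaths 1 (survives L s (fun _ : Fin 1 => x))ᶜ ≤ 6 * ENNReal.ofReal (Real.exp (-5)) := by
    have h1 := measure_not_survives_le (N := 1) L s hr (closedBall_subset_boxN_one hx)
    have htail : preWienerMeasure {η | ∃ u ≤ s, L / 4 / Real.sqrt 6 ≤ |brownian u η|} ≤
        ENNReal.ofReal (2 * Real.exp (-5)) := by
      refine (Literature.Probability.RandomPlanarGeometry.measure_exists_le_abs_brownian_le_exp s ha).trans
        (ENNReal.ofReal_le_ofReal ?_)
      refine mul_le_mul_of_nonneg_left (Real.exp_le_exp.2 ?_) (by norm_num)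
      -- `-(L/4/√6)²/(2 s) ≤ -5` since `s ≤ L²/960`
      have h6 : Real.sqrt 6 ^ 2 = 6 := Real.sq_sqrt (by norm_num)
      have hsq : (L / 4 / Real.sqrt 6) ^ 2 = L ^ 2 / 96 := by
        rw [div_pow, div_pow, h6]; ring
      rw [hsq, neg_div, neg_le_neg_iff, le_div_iff₀ (by positivity)]
      nlinarith
    calc wienerPaths 1 (survives L s (fun _ : Fin 1 => x))ᶜ
        ≤ ∑ _i : Fin 1, ∑ _k : Fin 3, preWienerMeasure {η | ∃ u ≤ s, L / 4 / Real.sqrt 6 ≤ |brownian u η|} := h1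
      _ ≤ ∑ _i : Fin 1, ∑ _k : Fin 3, ENNReal.ofReal (2 * Real.exp (-5)) :=
          Finset.sum_le_sum fun _ _ => Finset.sum_le_sum fun _ _ => htail
      _ = 6 * ENNReal.ofReal (Real.exp (-5)) := by
          simp only [Finset.sum_const, Finset.card_univ, Fintype.card_fin, nsmul_eq_mul, Nat.cast_ofNat,
            Nat.cast_one, one_mul]
          rw [ENNReal.ofReal_mul (by norm_num : (0:ℝ) ≤ 2), ENNReal.ofReal_ofNat]
          ring
  have hadd : wienerPaths 1 (survives L s (fun _ : Fin 1 => x)) +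
      wienerPaths 1 (survives L s (fun _ : Fin 1 => x))ᶜ = 1 := by
    rw [measure_add_measure_compl (measurableSet_survives L s _), measure_univ]
  calc 1 - 6 * ENNReal.ofReal (Real.exp (-5))
      ≤ 1 - wienerPaths 1 (survives L s (fun _ : Fin 1 => x))ᶜ := tsub_le_tsub_left hc _
    _ ≤ wienerPaths 1 (survives L s (fun _ : Fin 1 => x)) :=
        tsub_le_iff_right.2 (le_of_eq hadd.symm)

/-- The constant `q₀ = 1 - 6e⁻⁵` is positive (`e⁵ > 6`). [folklore] -/
theorem q0_pos : 0 < 1 - 6 * Real.exp (-5) := by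
  have h : (6 : ℝ) < Real.exp 5 := by
    have := Real.add_one_lt_exp (by norm_num : (5:ℝ) ≠ 0); linarith
  rw [Real.exp_neg, sub_pos, ← div_eq_mul_inv, div_lt_one (Real.exp_pos 5)]
  exact h

/-- `q₀` in `[0, ∞]`: `1 - 6·ofReal e⁻⁵ = ofReal (1 - 6 e⁻⁵)`. [folklore] -/
theorem q0_eq : (1 : ℝ≥0∞) - 6 * ENNReal.ofReal (Real.exp (-5)) = ENNReal.ofReal (1 - 6 * Real.exp (-5)) := by
  rw [ENNReal.ofReal_sub _ (by positivity), ENNReal.ofReal_one, ENNReal.ofReal_mul (by norm_num),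
    ENNReal.ofReal_ofNat]

/-- **`Z^{(1)}_T ≥ q₀` on the middle cube for `0 ≤ T ≤ L²/960`** (monotonicity in `T` down to the scale
`L²/960`, then `survives_one_ge`). [folklore] -/
theorem fkPartition_one_ge_on_middle {v : ℝ → ℝ≥0∞} (hv : Measurable v) {L : ℝ} (hL : 0 < L) {x : Space}
    (hx : ∀ k, x k ∈ Set.Ioo (L / 4) (3 * L / 4)) {T : ℝ} (hT0 : 0 ≤ T) (hT : T ≤ L ^ 2 / 960) :
    ENNReal.ofReal (1 - 6 * Real.exp (-5)) ≤ fkPartition (N := 1) v L T (fun _ => x) := by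
  -- monotone down to `s₀ = L²/960`
  have hs0 : 0 < L ^ 2 / 960 := by positivity
  have hmono : fkPartition (N := 1) v L (L ^ 2 / 960) (fun _ => x) ≤ fkPartition (N := 1) v L T (fun _ => x) := by
    have := fkSemigroup_one_add_le (N := 1) hv L hT0 (sub_nonneg.2 hT) (fun _ => x)
    rwa [add_sub_cancel] at this
  refine le_trans ?_ hmono
  rw [fkPartition_config_one, ← q0_eq]
  have h := survives_one_ge hL hx (s := (L ^ 2 / 960).toNNReal) (by simpa using hs0)
    (by rw [Real.coe_toNNReal _ hs0.le])
  rwa [Real.coe_toNNReal _ hs0.le] at h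

end Summit.AtomisticToContinuum.BoseEinsteinCondensation.Cruxes.TwoReplicaTransienceBound.FreeGas

namespace Summit.AtomisticToContinuum.BoseEinsteinCondensation.Cruxes.TwoReplicaTransienceBound.TracerDecoupling

open Literature.MathematicalPhysics.QuantumManyBody.BoseGas

/-- **Registered toolbox stub `stub_fkNormSqLadder`** (crux stmt-AtomisticToContinuum-9687, line
`SketchIdeator1`): the log-convexity ladder with a general step, `Z(T-h)·Z(2h) ≤ Z(0)·Z(T)` for
`T ≥ h > 0`, `Z(s) = ‖e^{-sH_N}1‖₂²`, every measurable pair potential (`= FreeGas.fkNormSq_ladder`). -/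
theorem stub_fkNormSqLadder :
    ∀ (N : ℕ) (v : ℝ → ENNReal), Measurable v → ∀ (L h : ℝ), 0 < h → ∀ (T : ℝ), h ≤ T →
      @fkNormSq N v L (T - h) (fun _ => (1 : ENNReal)) * @fkNormSq N v L (2 * h) (fun _ => (1 : ENNReal)) ≤
        @fkNormSq N v L 0 (fun _ => (1 : ENNReal)) * @fkNormSq N v L T (fun _ => (1 : ENNReal)) :=
  fun _ _ hv L _ hh _ hT => FreeGas.fkNormSq_ladder hv L hh hT

end Summit.AtomisticToContinuum.BoseEinsteinCondensation.Cruxes.TwoReplicaTransienceBound.TracerDecoupling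

end
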